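import Summits.KontsevichZagierPeriods.KontsevichZagierPeriods.Theorems.RootDecompWalshStrataSplit4Chart

/-!
# The split specimen `xy + zw > 1`, part 3/3: the second descent and the assembly

Route `RootDecompWalshStrata` (cell decomp-kz, lens 4, gen 11), support toward `QuadricSignKernel`
(item stmt-KontsevichZagierPeriods-25393), slice `d = 4`.  The 3-cell `T₂` of part 2 is the open band
`1 − t₁ < v₂ < t₀` over the triangle `Δ = (0,1)² ∩ {t₀ + t₁ > 1}` (POLYNOMIAL edges); Newton–Leibniz
along `v₂` with the primitive `q((v₁ − 1)v₂ + v₂²/2)/(v₀v₁)` (rule (3)) and opening the fibres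
(rule (1a)) land on the RATIONAL 2-cell `Δ_q = [Δ, q(t₀ + t₁ − 1)²/(2t₀t₁)]` (value `q(π²/12 − 3/4)`).
Main results: `of_cell_sub_of_triRep_mem_relations` (`[split cell, q] − Δ_q ∈ KZ.relations`) and
`split4_twoDescent` — the split quadric 4-cell `x₀x₁ + x₂x₃ > 1` (signature `(2,2)`) is a third
instance, after the 4-ball and the paraboloid, of the `d = 4` quadric descent of the gen-11 node,
decided INSIDE the three KZ rules by THREE moves and with no square root anywhere: its "hyperbolic
Dirichlet chart" is the polynomial map `(x, y) ↦ (xy, y)`.  0 sorry.  [KontsevichZagier2001 §1.2]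
-/

noncomputable section

open Literature.NumberTheory.Transcendental
open MeasureTheory Set
open MvPolynomial (aeval X C)
open Literature.ModelTheory.ExponentialFields (IsSemialgebraic isSemialgebraic_setOf_eval_pos
  isSemialgebraic_setOf_eval_lt continuous_aeval_real)
open Summit.KontsevichZagierPeriods.RootDecompWalshStrata.WalshSpanProof (isSemialgebraic_cubeSet
  isBounded_cubeSet cellRep cellRep_domain cellRep_integrand)
open Summit.KontsevichZagierPeriods.RootDecompWalshStrata.ConeSpecimen (cubeCell_subset_Icc)

namespace Summit.KontsevichZagierPeriods.RootDecompWalshStrata.Split4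

/-! #### The triangle `Δ` and the rational 2-cell `Δ_q` -/

/-- The triangle inequality `t₀ + t₁ − 1`. -/
def triPoly : MvPolynomial (Fin 2) ℚ := X 0 + X 1 - 1

/-- Evaluation. [definition] -/
@[simp] theorem aeval_triPoly (t : Fin 2 → ℝ) : aeval t triPoly = t 0 + t 1 - 1 := by simp [triPoly]

/-- The triangle `Δ = (0,1)² ∩ {t₀ + t₁ > 1}` (a Walsh 2-cell). -/
def triSet : Set (Fin 2 → ℝ) := {t | (∀ j, 0 < t j ∧ t j < 1) ∧ 0 < aeval t triPoly}

/-- `Δ` is `ℚ`-semialgebraic. [BCR1998 §2.1] -/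
theorem isSemialgebraic_triSet : IsSemialgebraic ℚ triSet := (cellRep triPoly 0).isSemialgebraic_domain

/-- `Δ ⊆ [0,1]²`. [folklore] -/
theorem triSet_subset_Icc : triSet ⊆ Icc 0 1 := cubeCell_subset_Icc triPoly

/-- Membership in `Δ`, in coordinates. [definition] -/
theorem mem_triSet {t : Fin 2 → ℝ} :
    t ∈ triSet ↔ ((0 < t 0 ∧ t 0 < 1) ∧ (0 < t 1 ∧ t 1 < 1)) ∧ 0 < t 0 + t 1 - 1 := by
  simp only [triSet, mem_setOf_eq, aeval_triPoly]
  exact ⟨fun ⟨hu, hc⟩ => ⟨⟨hu 0, hu 1⟩, hc⟩, fun ⟨⟨h0, h1⟩, hc⟩ =>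
    ⟨fun j => by fin_cases j <;> assumption, hc⟩⟩

/-- Membership of the first two coordinates of `v ∈ ℝ³` in `Δ`. [definition] -/
theorem init_mem_triSet {v : Fin 3 → ℝ} :
    Fin.init v ∈ triSet ↔ ((0 < v 0 ∧ v 0 < 1) ∧ (0 < v 1 ∧ v 1 < 1)) ∧ 0 < v 0 + v 1 - 1 := by
  rw [mem_triSet]
  rfl

/-- On `Δ`: `0 < (t₀ + t₁ − 1)²/(2t₀t₁) < 1` (`t₀ + t₁ − 1 ≤ t₀t₁ ≤ 1`). [folklore] -/
theorem ratio₃_mem_Ioo {t : Fin 2 → ℝ} (ht : t ∈ triSet) :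
    0 < (t 0 + t 1 - 1) ^ 2 / (2 * (t 0 * t 1)) ∧ (t 0 + t 1 - 1) ^ 2 / (2 * (t 0 * t 1)) < 1 := by
  rw [mem_triSet] at ht
  obtain ⟨⟨h0, h1⟩, hc⟩ := ht
  have hp : 0 < t 0 * t 1 := mul_pos h0.1 h1.1
  have hep : t 0 + t 1 - 1 ≤ t 0 * t 1 := by
    nlinarith [mul_nonneg (sub_nonneg.2 h0.2.le) (sub_nonneg.2 h1.2.le)]
  have hp1 : t 0 * t 1 ≤ 1 := by nlinarith
  refine ⟨div_pos (by positivity) (by positivity), (div_lt_one (by positivity)).2 ?_⟩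
  nlinarith [mul_nonneg hc.le (sub_nonneg.2 hep), mul_nonneg (sub_nonneg.2 (hep.trans hp1)) hp.le]

/-- `Δ_q = [Δ, q(t₀ + t₁ − 1)²/(2t₀t₁)]`: a RATIONAL function on a rational 2-cell (value
`q(π²/12 − 3/4)`). [KontsevichZagier2001 §1.1] -/
def triRep (q : ℚ) : KZ.IntegralRep 2 where
  domain := triSet
  integrand t := (q : ℝ) * (t 0 + t 1 - 1) ^ 2 / (2 * (t 0 * t 1))
  isSemialgebraic_domain := isSemialgebraic_triSet
  isSemialgebraicFunOn_integrand :=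
    (isSemialgebraicFunOn_aeval_div_aeval isSemialgebraic_triSet (C q * (X 0 + X 1 - 1) ^ 2)
      (2 * (X 0 * X 1)) fun t ht => by
        have h := (mem_triSet.1 ht).1
        simpa using (mul_pos h.1.1 h.2.1).ne').congr fun t _ => by simp
  integrableOn := by
    refine integrableOn_of_bdd triSet_subset_Icc isSemialgebraic_triSet.measurableSet_holds
      (by fun_prop) |(q : ℝ)| fun t ht => ?_
    have hr := ratio₃_mem_Ioo ht
    rw [mul_div_assoc, abs_mul, abs_of_pos hr.1]
    exact mul_le_of_le_one_right (abs_nonneg _) hr.2.le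

/-- The domain of `Δ_q`. [definition] -/
@[simp] theorem triRep_domain (q : ℚ) : (triRep q).domain = triSet := rfl

/-- The integrand of `Δ_q`. [definition] -/
@[simp] theorem triRep_integrand (q : ℚ) (t : Fin 2 → ℝ) :
    (triRep q).integrand t = (q : ℝ) * (t 0 + t 1 - 1) ^ 2 / (2 * (t 0 * t 1)) := rfl

/-- **`Δ_q` is a rational representation of dimension 2.** [KontsevichZagier2001 §1.1] -/
theorem isRational_triRep (q : ℚ) : (triRep q).IsRational := by
  refine ⟨C q * (X 0 + X 1 - 1) ^ 2, 2 * (X 0 * X 1), fun t ht => ?_, fun t _ => ?_⟩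
  · have h := (mem_triSet.1 ht).1
    simpa using (mul_pos h.1.1 h.2.1).ne'
  · simp

/-! #### The band: `T₂` is the open band `1 − t₁ < v₂ < t₀` over `Δ` -/

/-- Coordinates of `Fin.snoc` on `ℝ² × ℝ`. [definition] -/
@[simp] private theorem snoc₂_apply (t : Fin 2 → ℝ) (s : ℝ) :
    (Fin.snoc t s : Fin 3 → ℝ) 2 = s ∧ (Fin.snoc t s : Fin 3 → ℝ) 0 = t 0 ∧
      (Fin.snoc t s : Fin 3 → ℝ) 1 = t 1 := ⟨rfl, rfl, rfl⟩

/-- The lower edge `1 − t₁`. -/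
def loEdge₂ (t : Fin 2 → ℝ) : ℝ := 1 - t 1

/-- The upper edge `t₀`. -/
def upEdge₂ (t : Fin 2 → ℝ) : ℝ := t 0

/-- The lower edge is `ℚ`-semialgebraic (a polynomial). [BCR1998 §2.2] -/
theorem isSemialgebraicFunOn_loEdge₂ : IsSemialgebraicFunOn ℚ triSet loEdge₂ :=
  (isSemialgebraicFunOn_aeval isSemialgebraic_triSet (1 - X 1 : MvPolynomial (Fin 2) ℚ)).congr
    fun t _ => by simp [loEdge₂]

/-- The upper edge is `ℚ`-semialgebraic (a coordinate). [BCR1998 §2.2] -/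
theorem isSemialgebraicFunOn_upEdge₂ : IsSemialgebraicFunOn ℚ triSet upEdge₂ :=
  (isSemialgebraicFunOn_aeval isSemialgebraic_triSet (X 0 : MvPolynomial (Fin 2) ℚ)).congr
    fun t _ => by simp [upEdge₂]

/-- Membership in `T₂` in band form. [folklore] -/
theorem mem_t2Set_iff_init (v : Fin 3 → ℝ) :
    v ∈ t2Set ↔ Fin.init v ∈ triSet ∧ loEdge₂ (Fin.init v) < v (Fin.last 2) ∧
      v (Fin.last 2) < upEdge₂ (Fin.init v) := by
  rw [mem_t2Set]
  have ha : loEdge₂ (Fin.init v) = 1 - v 1 := rfl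
  have hb : upEdge₂ (Fin.init v) = v 0 := rfl
  have hl : v (Fin.last 2) = v 2 := rfl
  rw [init_mem_triSet, ha, hb, hl]
  constructor
  · rintro ⟨⟨h0, h1, h2⟩, hc, hlt⟩
    exact ⟨⟨⟨h0, h1⟩, by linarith⟩, by linarith, hlt⟩
  · rintro ⟨⟨⟨h0, h1⟩, _⟩, hlo, hlt⟩
    exact ⟨⟨h0, h1, by linarith, by linarith⟩, by linarith, hlt⟩

/-- The closed band lies in `[0,1]³`. [folklore] -/
theorem band_triSet_subset_Icc : KZlog.band triSet loEdge₂ upEdge₂ ⊆ Icc 0 1 := by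
  intro v hv
  rw [KZlog.mem_band] at hv
  obtain ⟨hu, h0, h1⟩ := hv
  have hu' := (init_mem_triSet.1 hu).1
  have ha : loEdge₂ (Fin.init v) = 1 - v 1 := rfl
  have hb : upEdge₂ (Fin.init v) = v 0 := rfl
  have hl : v (Fin.last 2) = v 2 := rfl
  rw [ha, hl] at h0
  rw [hb, hl] at h1
  refine ⟨fun j => ?_, fun j => ?_⟩
  · fin_cases j
    · exact hu'.1.1.le
    · exact hu'.2.1.le
    · change 0 ≤ v 2
      linarith [hu'.2.2]
  · fin_cases j
    · exact hu'.1.2.le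
    · exact hu'.2.2.le
    · change v 2 ≤ 1
      linarith [hu'.1.2]

/-- On the closed band the weight `q(v₁ + v₂ − 1)/(v₀v₁)` is bounded by `|q|`. [folklore] -/
theorem abs_weight_le {q : ℚ} {v : Fin 3 → ℝ} (hv : v ∈ KZlog.band triSet loEdge₂ upEdge₂) :
    |(q : ℝ) * (v 1 + v 2 - 1) / (v 0 * v 1)| ≤ |(q : ℝ)| := by
  rw [KZlog.mem_band] at hv
  obtain ⟨hu, h0, h1⟩ := hv
  have hu' := (init_mem_triSet.1 hu).1
  have ha : loEdge₂ (Fin.init v) = 1 - v 1 := rfl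
  have hb : upEdge₂ (Fin.init v) = v 0 := rfl
  have hl : v (Fin.last 2) = v 2 := rfl
  rw [ha, hl] at h0
  rw [hb, hl] at h1
  have hp : 0 < v 0 * v 1 := mul_pos hu'.1.1 hu'.2.1
  have hnum : 0 ≤ v 1 + v 2 - 1 := by linarith
  have hle : v 1 + v 2 - 1 ≤ v 0 * v 1 := by
    nlinarith [mul_nonneg (sub_nonneg.2 hu'.1.2.le) (sub_nonneg.2 hu'.2.2.le)]
  rw [mul_div_assoc, abs_mul, abs_of_nonneg (div_nonneg hnum hp.le)]
  exact mul_le_of_le_one_right (abs_nonneg _) ((div_le_one hp).2 hle)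

/-! #### Moves (3) + (1a): `[T₂, …] ≡ Δ_q` -/

/-- **Moves (3) + (1a):** Newton–Leibniz along `v₂` with the primitive `q((v₁ − 1)v₂ + v₂²/2)/(v₀v₁)`
over `Δ` (closed fibres `[1 − t₁, t₀]`), then opening the fibres: `[T₂, …] − Δ_q ∈ KZ.relations`.
[KontsevichZagier2001 §1.2 rules (1), (3)] -/
theorem of_t2Rep_sub_of_triRep_mem_relations (q : ℚ) :
    KZ.of (t2Rep q) - KZ.of (triRep q) ∈ KZ.relations := by
  have hBs := isSemialgebraic_triSet
  have ha : IsSemialgebraicFunOn ℚ triSet loEdge₂ := isSemialgebraicFunOn_loEdge₂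
  have hb : IsSemialgebraicFunOn ℚ triSet upEdge₂ := isSemialgebraicFunOn_upEdge₂
  have hab : ∀ t ∈ triSet, loEdge₂ t ≤ upEdge₂ t := fun t ht => by
    have h := (mem_triSet.1 ht).2
    simp only [loEdge₂, upEdge₂]
    linarith
  have hband : IsSemialgebraic ℚ (KZlog.band triSet loEdge₂ upEdge₂) := KZlog.isSemialgebraic_band ha hb
  have hden : ∀ v ∈ KZlog.band triSet loEdge₂ upEdge₂,
      aeval v (X 0 * X 1 : MvPolynomial (Fin 3) ℚ) ≠ 0 := fun v hv => by
    have hu := (init_mem_triSet.1 (KZlog.mem_band.1 hv).1).1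
    simpa using (mul_pos hu.1.1 hu.2.1).ne'
  set F : (Fin 3 → ℝ) → ℝ := fun v =>
    (q : ℝ) * ((v 1 - 1) * v 2 + v 2 ^ 2 / 2) / (v 0 * v 1) with hFdef
  have hbdry : ∀ t ∈ triSet,
      F (Fin.snoc t (upEdge₂ t)) - F (Fin.snoc t (loEdge₂ t)) = (triRep q).integrand t := by
    intro t ht
    have hu := (mem_triSet.1 ht).1
    have h0 : t 0 ≠ 0 := hu.1.1.ne'
    have h1 : t 1 ≠ 0 := hu.2.1.ne'
    simp only [hFdef, snoc₂_apply, triRep_integrand, upEdge₂, loEdge₂]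
    field_simp
    ring
  obtain ⟨rb, rd, hrbd, hrbi, hrdd, hrdi, hrel⟩ := KZ.exists_band_newtonLeibniz hBs
    loEdge₂ upEdge₂ ha hb hab F (fun v => (q : ℝ) * (v 1 + v 2 - 1) / (v 0 * v 1))
    ((isSemialgebraicFunOn_aeval_div_aeval hband
      (C q * ((X 1 - 1) * X 2 + C (1 / 2) * X 2 ^ 2)) (X 0 * X 1) hden).congr fun v _ => by
        simp only [hFdef]
        simp
        ring)
    ((isSemialgebraicFunOn_aeval_div_aeval hband (C q * (X 1 + X 2 - 1)) (X 0 * X 1) hden).congr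
      fun v _ => by simp)
    (fun t _ => by
      simp only [hFdef, snoc₂_apply]
      exact ((continuous_const.mul ((continuous_const.mul continuous_id).add
        ((continuous_pow 2).div_const _))).div_const _).continuousOn)
    (fun t _ s _ => by
      simp only [hFdef, snoc₂_apply]
      exact (((((hasDerivAt_id s).const_mul (t 1 - 1)).add ((hasDerivAt_pow 2 s).div_const 2)).const_mul
        (q : ℝ)).div_const (t 0 * t 1)).congr_deriv (by simp; ring))
    (integrableOn_of_bdd band_triSet_subset_Icc hband.measurableSet_holds (by fun_prop) |(q : ℝ)|
      fun v hv => abs_weight_le hv)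
    ((triRep q).isSemialgebraicFunOn_integrand.congr fun t ht => (hbdry t ht).symm)
    (((triRep q).integrableOn.congr_fun (fun t ht => (hbdry t ht).symm)
      isSemialgebraic_triSet.measurableSet_holds))
  obtain ⟨rb', hrb'd, hrb'i, hrel'⟩ := KZ.of_sub_of_restrict_openBand_mem_relations ha hb rb hrbd
  have hpin1 : KZ.of rb' - KZ.of (t2Rep q) ∈ KZ.relations := by
    refine KZ.of_sub_of_mem_relations_of_eqOn ?_ fun v _ => ?_
    · rw [hrb'd, t2Rep_domain]
      ext v
      exact mem_t2Set_iff_init v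
    · rw [hrb'i, hrbi]
      rfl
  have hpin2 : KZ.of rd - KZ.of (triRep q) ∈ KZ.relations := by
    refine KZ.of_sub_of_mem_relations_of_eqOn ?_ fun t ht => ?_
    · rw [triRep_domain, hrdd]
    · rw [hrdi]
      rw [hrdd] at ht
      exact hbdry t ht
  have : KZ.of (t2Rep q) - KZ.of (triRep q) =
      (KZ.of rb - KZ.of rd) - (KZ.of rb - KZ.of rb') - (KZ.of rb' - KZ.of (t2Rep q)) +
        (KZ.of rd - KZ.of (triRep q)) := by abel
  rw [this]
  exact add_mem (sub_mem (sub_mem hrel hrel') hpin1) hpin2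

/-! #### Assembly: the split cell lands on the rational 2-cell `Δ_q` -/

/-- **`[(0,1)⁴ ∩ {x₀x₁ + x₂x₃ > 1}, q] − Δ_q ∈ KZ.relations`:** the split quadric 4-cell with constant
weight `q` is equivalent under the three KZ rules to the RATIONAL dimension-2 representation
`Δ_q = [Δ, q(t₀ + t₁ − 1)²/(2t₀t₁)]` (three moves; `q(π²/12 − 3/4)` both sides).
[KontsevichZagier2001 §1.2; this node] -/
theorem of_cell_sub_of_triRep_mem_relations (q : ℚ) :
    KZ.of (cellRep split4Poly q) - KZ.of (triRep q) ∈ KZ.relations := by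
  have h1 := of_cell_sub_of_b1WRep_mem_relations q
  have h2 := of_b1WRep_sub_of_t2Rep_mem_relations q
  have h3 := of_t2Rep_sub_of_triRep_mem_relations q
  have : KZ.of (cellRep split4Poly q) - KZ.of (triRep q) =
      (KZ.of (cellRep split4Poly q) - KZ.of (b1WRep q)) + (KZ.of (b1WRep q) - KZ.of (t2Rep q)) +
        (KZ.of (t2Rep q) - KZ.of (triRep q)) := by abel
  rw [this]
  exact add_mem (add_mem h1 h2) h3

/-- **The split quadric cell is an instance of the `d = 4` quadric descent** (`P = x₀x₁ + x₂x₃ − 1`,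
any rational weight `q`): every representation with the split cell as domain and integrand `q` is
equivalent, modulo `KZ.relations`, to an element of the closure of the RATIONAL representations of
dimension `≤ 2`.  Decided INSIDE the rules; the `P := split4Poly` instance of `QuadricTwoDescentFour`
(gen-11 node).  [KontsevichZagier2001 §1.2; this node] -/
theorem split4_twoDescent (q : ℚ) (ρ : KZ.IntegralRep 4)
    (hρ : ρ.domain = {x | (∀ j, 0 < x j ∧ x j < 1) ∧ 0 < MvPolynomial.aeval x split4Poly} ∧
      ∀ x ∈ ρ.domain, ρ.integrand x = (q : ℝ)) :
    ∃ y ∈ AddSubgroup.closure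
        {y : KZ.FormalRep | ∃ (m : ℕ) (N : KZ.IntegralRep m), m ≤ 2 ∧ N.IsRational ∧ y = KZ.of N},
      KZ.of ρ - y ∈ KZ.relations := by
  refine ⟨KZ.of (triRep q),
    AddSubgroup.subset_closure ⟨2, triRep q, le_rfl, isRational_triRep q, rfl⟩, ?_⟩
  have hpin : KZ.of ρ - KZ.of (cellRep split4Poly q) ∈ KZ.relations :=
    KZ.of_sub_of_mem_relations_of_eqOn hρ.1.symm fun x hx => by
      rw [hρ.2 x hx, cellRep_integrand]
  have : KZ.of ρ - KZ.of (triRep q) =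
      (KZ.of ρ - KZ.of (cellRep split4Poly q)) +
        (KZ.of (cellRep split4Poly q) - KZ.of (triRep q)) := by abel
  rw [this]
  exact add_mem hpin (of_cell_sub_of_triRep_mem_relations q)

end Summit.KontsevichZagierPeriods.RootDecompWalshStrata.Split4

end
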